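/-
Copyright (c) 2026 the pub-hodgecm-mathlib formalisation cell (harness21).  Prover seat hodgecm-mathlib-K2E4-p10 (g7), Track B ∕ K2-LIT, h413 = `stmt-HodgeConjecture-24833`,
line `K2_E1_TraceFormulaBeta`, 5Res ROADCARD AMENDMENT #3 rung G8 (dealer K2E1-plan (g7) (266)∕(267)) FILE 1: the MATRIX LETTERS of the self-dual block isometry ★ :184 at rank `> 1`
read off COORDINATE data — `M(z) v_a = Σ_c m_z(c,a) v_c` on the span model `W = span {v_a}` (`v` linearly independent): `hFE` from the matrix functional equation, `hs`∕`hB`∕`hcont` from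
holomorphy∕bounds∕continuity of the coordinates, `hadj`∕`hRsymm` from the K-pairing adjointness in coordinate form, `hr` from coordinate residues.  Mathlib + ★ p860844.
-/
import Summits.HodgeConjecture.HodgeConjecture.Theorems.K2E1SpanOperatorOfEntries     -- ★ p860844 (this seat): `hadj_of_span_entries`, `hRsymm_of_span_entries`, `hcont_of_span_entries`
import Mathlib.Analysis.Complex.Basic
import Mathlib.Analysis.Calculus.Deriv.Mul
import Mathlib.Analysis.Calculus.Deriv.Add
import HarnessLib

/-!
# G8 FILE 1 — `K2E1SpanOperatorMatrixLetters`: the ★ :184 letters `hFE`, `hs`, `hB`, `hcont`, `hadj`, `hr`, `hRsymm` for an operator family given by COORDINATES on `W = span {v_a}`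

Track B ∕ K2-LIT, crux h413 = `stmt-HodgeConjecture-24833`, route of record `HCCMUnconditional`; cell `hodgecm-mathlib`, squad K2, ENGINE E1; AMENDMENT #3 «GENERAL (U,τ) LADDER» rung G8
(`hFE`∕`hcont`∕`hadj` at `dim V(χ,K′,ω) > 1`).  THEOREMS ONLY (no `def`, no `instance`, no `notation`, no named-fact hypothesis, no `sorry`); lane `--supports stmt-HodgeConjecture-24833 --as
helper` (count-neutral).  GENERIC: `E` a complex inner-product space, `v : α → E` linearly independent and finite, `W := span {v_a}` (E1: `v_a = [φ_a|_{K_U}] ∈ L²(K_U)`, `(φ_a)` a basis of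
`V(χ, K′, ω)`, `χ` self-dual); FILE 2 `K2E1ChiScatteringMatrixLettersLevelCMTwo` instantiates the coordinates with the scattering coordinates `qc` of ★ p860855 (G3 exports).
THE MATHEMATICS ([MoeglinWaldspurger1995, II.1.8, IV.1.8–IV.1.11]; [HornJohnson2013, §0.6]).  Two currencies describe `M(z) ∈ End W`: ENTRIES `⟪v_b, M(z)v_a⟫_W` (the `hSD`∕`hadj` side, ★
p860844) and COORDINATES `M(z) v_a = Σ_c m_z(c,a) v_c` (the Bernstein–Lapid column currency of ★ C3 `sum_coeff_smul_coeff_eq_of_packages`: `m_z(c,a) = qc_{a,c}(z)`); since `v` is a basis of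
`W` they are linked by `⟪v_b, M(z)v_a⟫ = Σ_c m_z(c,a)·⟪v_b, v_c⟫` (§1).  Then: the MATRIX FUNCTIONAL EQUATION `Σ_c m_{1−z}(d,c)·m_z(c,a) = δ_{da}` gives `M(1−z)M(z) = 1` on `W` (§2 `hFE`);
holomorphy ∕ a strip bound ∕ axis continuity of the coordinates give the entry letters `hs`, `hB` and (★ p860844) the vector letter `hcont` (§3); the K-PAIRING ADJOINTNESS in coordinate form
`Σ_c m_z(c,a)⟪v_b,v_c⟫ = conj(Σ_c m_{z̄}(c,b)⟪v_a,v_c⟫)` (MW II.1.8: `⟪I(z)φ_a, φ_b⟫_K = ⟪φ_a, I(z̄)φ_b⟫_K`) gives `hadj` (§4, ★ p860844); coordinate residues `(z−c)·m_z(d,a) → ρ_c(d,a)` give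
the residue operators `R_c v_a := Σ_d ρ_c(d,a) v_d` with `hr`, and their symmetry from the coordinate identity (§5).  `hRpos` (positivity) is not entrywise and stays with ★ p860415 §2.
* §1 **`exists_family_span_of_coords`** (`∃ M : X → End W`, `M_x v_a = Σ_c m_x(c,a) v_c`), `eq_of_span_coords_eq`, **`inner_apply_of_coords`** (entries from coordinates).
* §2 **`hFE_of_coords`** (★ :184 `hFE` bytes).  * §3 **`hs_of_coords`**, **`hB_of_coords`**, **`hcont_of_coords`** (★ :184 `hs`∕`hB`-shape∕`hcont` bytes).
* §4 **`hadj_of_coords`** (★ :184 `hadj` bytes from (KA) in coordinates).  * §5 **`hr_of_coords`**, **`hRsymm_of_coords`** (★ :184 `hr`∕`hRsymm` bytes).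
HONEST LABEL: HC_CM is proved only modulo the 7 printed citations (2 remaining named inputs: hLiu418 = `stmt-HodgeConjecture-24832`, h413 = `stmt-HodgeConjecture-24833`) until rung 0
closes; this file asserts no named fact and closes no socket; count-neutral; Mathlib-level linear algebra over ★ p860844.

## References
* [MoeglinWaldspurger1995] C. Mœglin, J.-L. Waldspurger, *Spectral decomposition and Eisenstein series* (1995), II.1.8, IV.1.8–IV.1.11.
* [HornJohnson2013] R. A. Horn, C. R. Johnson, *Matrix Analysis* (2nd ed., 2013), §0.6.
-/

set_option autoImplicit false
set_option linter.dupNamespace false  -- the mandated namespace repeats the summit's segment (`HodgeConjecture.HodgeConjecture`)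

noncomputable section

open Complex Module Filter Topology
open scoped InnerProductSpace ComplexConjugate BigOperators
open Summit.HodgeConjecture.HodgeConjecture.Cruxes.H413.K2E1SpanOperatorOfEntries (hadj_of_span_entries hRsymm_of_span_entries continuous_apply_of_span_entries)

namespace Summit.HodgeConjecture.HodgeConjecture.Cruxes.H413.K2E1SpanOperatorMatrixLetters

variable {E : Type*} [NormedAddCommGroup E] [InnerProductSpace ℂ E] {α : Type*} [Fintype α] {v : α → E}

/-! ## §1 Operators from coordinates on the basis `v` of `W = span {v_a}`; entries from coordinates -/

/-- **FAMILIES OF OPERATORS WITH PRESCRIBED COORDINATES**: for `v` linearly independent and coordinate data `m_x(c,a)` there is `M : X → End_ℂ W` with **`M_x v_a = Σ_c m_x(c,a) • v_c`**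
(`Basis.constr` on the basis `v` of `W`).  HOW `M(z)` ∕ `R_c` are DEFINED at rank `> 1` from the scattering coordinates ∕ their residues. [cite: HornJohnson2013, §0.6] -/
theorem exists_family_span_of_coords (hv : LinearIndependent ℂ v) {X : Type*} (m : X → α → α → ℂ) :
    ∃ M : X → ↥(Submodule.span ℂ (Set.range v)) →ₗ[ℂ] ↥(Submodule.span ℂ (Set.range v)),
      ∀ x a, M x ⟨v a, Submodule.subset_span ⟨a, rfl⟩⟩ = ∑ c, m x c a • (⟨v c, Submodule.subset_span ⟨c, rfl⟩⟩ : ↥(Submodule.span ℂ (Set.range v))) := by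
  refine ⟨fun x => (Basis.span hv).constr ℂ fun a => ∑ c, m x c a • (⟨v c, Submodule.subset_span ⟨c, rfl⟩⟩ : ↥(Submodule.span ℂ (Set.range v))), fun x a => ?_⟩
  have hbw : (Basis.span hv) a = (⟨v a, Submodule.subset_span ⟨a, rfl⟩⟩ : ↥(Submodule.span ℂ (Set.range v))) := Basis.span_apply hv a
  rw [← hbw, Basis.constr_basis]

omit [Fintype α] in
/-- **An operator on `W` is determined by its values on the basis `v`.** [cite: HornJohnson2013, §0.6] -/
theorem eq_of_span_apply_eq (hv : LinearIndependent ℂ v) {M N : ↥(Submodule.span ℂ (Set.range v)) →ₗ[ℂ] ↥(Submodule.span ℂ (Set.range v))}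
    (h : ∀ a, M ⟨v a, Submodule.subset_span ⟨a, rfl⟩⟩ = N ⟨v a, Submodule.subset_span ⟨a, rfl⟩⟩) : M = N :=
  (Basis.span hv).ext fun a => by rw [show (Basis.span hv) a = (⟨v a, Submodule.subset_span ⟨a, rfl⟩⟩ : ↥(Submodule.span ℂ (Set.range v))) from Basis.span_apply hv a]; exact h a

omit [Fintype α] in
/-- **ENTRIES FROM COORDINATES**: `M v_a = Σ_c m(c,a) v_c ⟹ ⟪v_b, M v_a⟫ = Σ_c m(c,a)·⟪v_b, v_c⟫` (Gram matrix times coordinate matrix). [cite: HornJohnson2013, §0.6] -/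
theorem inner_apply_of_coords {M : ↥(Submodule.span ℂ (Set.range v)) →ₗ[ℂ] ↥(Submodule.span ℂ (Set.range v))} {s : Finset α} {m : α → α → ℂ}
    (hM : ∀ a, M ⟨v a, Submodule.subset_span ⟨a, rfl⟩⟩ = ∑ c ∈ s, m c a • (⟨v c, Submodule.subset_span ⟨c, rfl⟩⟩ : ↥(Submodule.span ℂ (Set.range v)))) (a b : α) :
    ⟪(⟨v b, Submodule.subset_span ⟨b, rfl⟩⟩ : ↥(Submodule.span ℂ (Set.range v))), M ⟨v a, Submodule.subset_span ⟨a, rfl⟩⟩⟫_ℂ =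
      ∑ c ∈ s, m c a * ⟪(⟨v b, Submodule.subset_span ⟨b, rfl⟩⟩ : ↥(Submodule.span ℂ (Set.range v))), ⟨v c, Submodule.subset_span ⟨c, rfl⟩⟩⟫_ℂ := by
  rw [hM, inner_sum]
  exact Finset.sum_congr rfl fun c _ => inner_smul_right _ _ _

/-! ## §2 `hFE` from the matrix functional equation of the coordinates -/

/-- **`M′ M = 1` ON `W` FROM THE MATRIX IDENTITY `Σ_c m′(d,c)·m(c,a) = δ_{da}`** (both operators given by coordinates on the basis `v`). [cite: MoeglinWaldspurger1995, IV.1.10] -/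
theorem apply_apply_eq_self_of_coords [DecidableEq α] (hv : LinearIndependent ℂ v) {M M' : ↥(Submodule.span ℂ (Set.range v)) →ₗ[ℂ] ↥(Submodule.span ℂ (Set.range v))} {m m' : α → α → ℂ}
    (hM : ∀ a, M ⟨v a, Submodule.subset_span ⟨a, rfl⟩⟩ = ∑ c, m c a • (⟨v c, Submodule.subset_span ⟨c, rfl⟩⟩ : ↥(Submodule.span ℂ (Set.range v))))
    (hM' : ∀ a, M' ⟨v a, Submodule.subset_span ⟨a, rfl⟩⟩ = ∑ c, m' c a • (⟨v c, Submodule.subset_span ⟨c, rfl⟩⟩ : ↥(Submodule.span ℂ (Set.range v))))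
    (hFE : ∀ d a, ∑ c, m' d c * m c a = if d = a then 1 else 0) (u : ↥(Submodule.span ℂ (Set.range v))) : M' (M u) = u := by
  have key : M'.comp M = LinearMap.id := by
    refine eq_of_span_apply_eq hv fun a => ?_
    rw [LinearMap.comp_apply, LinearMap.id_apply, hM, map_sum]
    simp_rw [map_smul, hM', Finset.smul_sum, smul_smul]
    rw [Finset.sum_comm]
    simp_rw [← Finset.sum_smul, mul_comm (m _ a), hFE, ite_smul, one_smul, zero_smul]
    rw [Finset.sum_ite_eq' Finset.univ a]
    simp only [Finset.mem_univ, if_true]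
  exact LinearMap.congr_fun key u

/-- **`hFE` OF ★ `exists_linearIsometry_chiSection_selfDual_cm_two` FROM COORDINATES**: `M(z) v_a = Σ_c m_z(c,a) v_c` and the matrix functional equation
`Σ_c m_{1−z}(d,c)·m_z(c,a) = δ_{da}` off `P` (★ C3 `sum_coeff_smul_coeff_eq_of_packages`' shape, `m_z(c,a) = cc_a(z)_c`) ⟹ `M(1−z)(M(z)u) = u`. [cite: MoeglinWaldspurger1995, IV.1.10] -/
theorem hFE_of_coords [DecidableEq α] (hv : LinearIndependent ℂ v) {M : ℂ → ↥(Submodule.span ℂ (Set.range v)) →ₗ[ℂ] ↥(Submodule.span ℂ (Set.range v))} {m : ℂ → α → α → ℂ}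
    (hM : ∀ z a, M z ⟨v a, Submodule.subset_span ⟨a, rfl⟩⟩ = ∑ c, m z c a • (⟨v c, Submodule.subset_span ⟨c, rfl⟩⟩ : ↥(Submodule.span ℂ (Set.range v)))) {P : Set ℂ}
    (hmFE : ∀ z : ℂ, z ∉ P → 1 - z ∉ P → ∀ d a, ∑ c, m (1 - z) d c * m z c a = if d = a then 1 else 0) :
    ∀ z : ℂ, z ∉ P → 1 - z ∉ P → ∀ u : ↥(Submodule.span ℂ (Set.range v)), M (1 - z) (M z u) = u :=
  fun z hz hz' u => apply_apply_eq_self_of_coords hv (hM z) (hM (1 - z)) (hmFE z hz hz') u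

/-! ## §3 `hs`, `hB`, `hcont` from holomorphy ∕ bounds ∕ continuity of the coordinates -/

omit [Fintype α] in
/-- **`hs` FROM COORDINATES**: coordinates differentiable on `D` ⟹ every entry `z ↦ ⟪v_b, M(z)v_a⟫` differentiable on `D`. [cite: MoeglinWaldspurger1995, IV.1.8] -/
theorem hs_of_coords {M : ℂ → ↥(Submodule.span ℂ (Set.range v)) →ₗ[ℂ] ↥(Submodule.span ℂ (Set.range v))} {s : Finset α} {m : ℂ → α → α → ℂ}
    (hM : ∀ z a, M z ⟨v a, Submodule.subset_span ⟨a, rfl⟩⟩ = ∑ c ∈ s, m z c a • (⟨v c, Submodule.subset_span ⟨c, rfl⟩⟩ : ↥(Submodule.span ℂ (Set.range v)))) {D : Set ℂ}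
    (hm : ∀ c a, DifferentiableOn ℂ (fun z => m z c a) D) (a b : α) :
    DifferentiableOn ℂ (fun z : ℂ => ⟪(⟨v b, Submodule.subset_span ⟨b, rfl⟩⟩ : ↥(Submodule.span ℂ (Set.range v))), M z ⟨v a, Submodule.subset_span ⟨a, rfl⟩⟩⟫_ℂ) D := by
  simp_rw [inner_apply_of_coords (hM _)]
  exact DifferentiableOn.fun_sum fun c _ => (hm c a).mul_const _

omit [Fintype α] in
/-- **`hB` FROM COORDINATES**: a bound `‖m_z(c,a)‖ ≤ B` on a region ⟹ `‖⟪v_b, M(z)v_a⟫‖ ≤ B·Σ_c ‖⟪v_b, v_c⟫‖` there. [cite: MoeglinWaldspurger1995, IV.1.11] -/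
theorem hB_of_coords {M : ℂ → ↥(Submodule.span ℂ (Set.range v)) →ₗ[ℂ] ↥(Submodule.span ℂ (Set.range v))} {s : Finset α} {m : ℂ → α → α → ℂ}
    (hM : ∀ z a, M z ⟨v a, Submodule.subset_span ⟨a, rfl⟩⟩ = ∑ c ∈ s, m z c a • (⟨v c, Submodule.subset_span ⟨c, rfl⟩⟩ : ↥(Submodule.span ℂ (Set.range v)))) {p : ℂ → Prop} {B : ℝ}
    (hmB : ∀ c a z, p z → ‖m z c a‖ ≤ B) (a b : α) (z : ℂ) (hz : p z) :
    ‖⟪(⟨v b, Submodule.subset_span ⟨b, rfl⟩⟩ : ↥(Submodule.span ℂ (Set.range v))), M z ⟨v a, Submodule.subset_span ⟨a, rfl⟩⟩⟫_ℂ‖ ≤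
      B * ∑ c ∈ s, ‖⟪(⟨v b, Submodule.subset_span ⟨b, rfl⟩⟩ : ↥(Submodule.span ℂ (Set.range v))), ⟨v c, Submodule.subset_span ⟨c, rfl⟩⟩⟫_ℂ‖ := by
  rw [inner_apply_of_coords (hM z), Finset.mul_sum]
  refine (norm_sum_le _ _).trans (Finset.sum_le_sum fun c _ => ?_)
  rw [norm_mul]
  exact mul_le_mul_of_nonneg_right (hmB c a z hz) (norm_nonneg _)

/-- **`hcont` OF ★ :184 FROM COORDINATES**: coordinates continuous on the unitary axis `½ + it` ⟹ `t ↦ M(½+it)u` continuous for every `u ∈ W` (entries are finite sums; ★ p860844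
`continuous_apply_of_span_entries`). [cite: MoeglinWaldspurger1995, IV.1.11] -/
theorem hcont_of_coords (hv : LinearIndependent ℂ v) {M : ℂ → ↥(Submodule.span ℂ (Set.range v)) →ₗ[ℂ] ↥(Submodule.span ℂ (Set.range v))} {m : ℂ → α → α → ℂ}
    (hM : ∀ z a, M z ⟨v a, Submodule.subset_span ⟨a, rfl⟩⟩ = ∑ c, m z c a • (⟨v c, Submodule.subset_span ⟨c, rfl⟩⟩ : ↥(Submodule.span ℂ (Set.range v))))
    (hmc : ∀ c a, Continuous fun t : ℝ => m ((((1 / 2 : ℝ)) : ℂ) + t * I) c a) :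
    ∀ u : ↥(Submodule.span ℂ (Set.range v)), Continuous fun t : ℝ => M ((((1 / 2 : ℝ)) : ℂ) + t * I) u := by
  refine fun u => continuous_apply_of_span_entries hv (M := fun t : ℝ => M ((((1 / 2 : ℝ)) : ℂ) + t * I)) (fun a b => ?_) u
  simp_rw [inner_apply_of_coords (hM _)]
  exact continuous_finsetSum _ fun c _ => (hmc c a).mul continuous_const

/-! ## §4 `hadj` from the K-pairing adjointness in coordinate form -/

/-- **`hadj` OF ★ :184 FROM THE K-PAIRING ADJOINTNESS IN COORDINATES** (MW II.1.8: `⟪I(z)φ_a, φ_b⟫_K = ⟪φ_a, I(z̄)φ_b⟫_K`, written on the basis: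
`Σ_c m_z(c,a)·⟪v_b, v_c⟫ = conj(Σ_c m_{z̄}(c,b)·⟪v_a, v_c⟫)` off `P`) ⟹ `⟪u, M(z)u′⟫ = ⟪M(z̄)u, u′⟫` on `W` (★ p860844 `hadj_of_span_entries`). [cite: MoeglinWaldspurger1995, II.1.8, IV.1.11] -/
theorem hadj_of_coords (hv : LinearIndependent ℂ v) {M : ℂ → ↥(Submodule.span ℂ (Set.range v)) →ₗ[ℂ] ↥(Submodule.span ℂ (Set.range v))} {m : ℂ → α → α → ℂ}
    (hM : ∀ z a, M z ⟨v a, Submodule.subset_span ⟨a, rfl⟩⟩ = ∑ c, m z c a • (⟨v c, Submodule.subset_span ⟨c, rfl⟩⟩ : ↥(Submodule.span ℂ (Set.range v)))) {P : Set ℂ}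
    (hKA : ∀ z : ℂ, z ∉ P → conj z ∉ P → ∀ a b,
      ∑ c, m z c a * ⟪(⟨v b, Submodule.subset_span ⟨b, rfl⟩⟩ : ↥(Submodule.span ℂ (Set.range v))), ⟨v c, Submodule.subset_span ⟨c, rfl⟩⟩⟫_ℂ =
        conj (∑ c, m (conj z) c b * ⟪(⟨v a, Submodule.subset_span ⟨a, rfl⟩⟩ : ↥(Submodule.span ℂ (Set.range v))), ⟨v c, Submodule.subset_span ⟨c, rfl⟩⟩⟫_ℂ)) :
    ∀ z : ℂ, z ∉ P → conj z ∉ P → ∀ u u' : ↥(Submodule.span ℂ (Set.range v)), ⟪u, M z u'⟫_ℂ = ⟪M (conj z) u, u'⟫_ℂ := by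
  refine hadj_of_span_entries hv fun z hz hz' a b => ?_
  rw [inner_apply_of_coords (hM z), hKA z hz hz' a b, ← inner_apply_of_coords (hM (conj z)), inner_conj_symm]

/-! ## §5 Residues: `hr` and `hRsymm` from coordinate residues -/

omit [Fintype α] in
/-- **`hr` OF ★ :184 FROM COORDINATE RESIDUES**: `(z − c)·m_z(d,a) → ρ_c(d,a)` on `𝓝[≠] c` for all `d, a` and `R_c v_a = Σ_d ρ_c(d,a) v_d` ⟹ `(z − c)·⟪v_b, M(z)v_a⟫ → ⟪v_b, R_c v_a⟫`.
[cite: MoeglinWaldspurger1995, IV.1.11] -/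
theorem hr_of_coords {M : ℂ → ↥(Submodule.span ℂ (Set.range v)) →ₗ[ℂ] ↥(Submodule.span ℂ (Set.range v))} {s : Finset α} {m : ℂ → α → α → ℂ}
    (hM : ∀ z a, M z ⟨v a, Submodule.subset_span ⟨a, rfl⟩⟩ = ∑ c ∈ s, m z c a • (⟨v c, Submodule.subset_span ⟨c, rfl⟩⟩ : ↥(Submodule.span ℂ (Set.range v))))
    {R : ℝ → ↥(Submodule.span ℂ (Set.range v)) →ₗ[ℂ] ↥(Submodule.span ℂ (Set.range v))} {ρ : ℝ → α → α → ℂ}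
    (hR : ∀ c a, R c ⟨v a, Submodule.subset_span ⟨a, rfl⟩⟩ = ∑ d ∈ s, ρ c d a • (⟨v d, Submodule.subset_span ⟨d, rfl⟩⟩ : ↥(Submodule.span ℂ (Set.range v)))) {S : Finset ℝ}
    (hρ : ∀ d a, ∀ c ∈ S, Tendsto (fun z : ℂ => (z - c) * m z d a) (𝓝[≠] (c : ℂ)) (𝓝 (ρ c d a))) :
    ∀ a b, ∀ c ∈ S, Tendsto (fun z : ℂ => (z - c) * ⟪(⟨v b, Submodule.subset_span ⟨b, rfl⟩⟩ : ↥(Submodule.span ℂ (Set.range v))), M z ⟨v a, Submodule.subset_span ⟨a, rfl⟩⟩⟫_ℂ)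
      (𝓝[≠] (c : ℂ)) (𝓝 ⟪(⟨v b, Submodule.subset_span ⟨b, rfl⟩⟩ : ↥(Submodule.span ℂ (Set.range v))), R c ⟨v a, Submodule.subset_span ⟨a, rfl⟩⟩⟫_ℂ) := by
  intro a b c hc
  simp_rw [inner_apply_of_coords (hM _), Finset.mul_sum, ← mul_assoc]
  rw [inner_apply_of_coords (hR c)]
  exact tendsto_finsetSum _ fun d _ => (hρ d a c hc).mul_const _

/-- **`hRsymm` OF ★ :184 FROM THE COORDINATE SYMMETRY OF THE RESIDUES**: `Σ_d ρ_c(d,a)⟪v_b, v_d⟫ = conj(Σ_d ρ_c(d,b)⟪v_a, v_d⟫)` (`c ∈ S`; the residue of (KA) at a real pole) ⟹ `R_c`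
symmetric on `W` (★ p860844 `hRsymm_of_span_entries`). [cite: MoeglinWaldspurger1995, IV.1.11] -/
theorem hRsymm_of_coords (hv : LinearIndependent ℂ v) {R : ℝ → ↥(Submodule.span ℂ (Set.range v)) →ₗ[ℂ] ↥(Submodule.span ℂ (Set.range v))} {ρ : ℝ → α → α → ℂ}
    (hR : ∀ c a, R c ⟨v a, Submodule.subset_span ⟨a, rfl⟩⟩ = ∑ d, ρ c d a • (⟨v d, Submodule.subset_span ⟨d, rfl⟩⟩ : ↥(Submodule.span ℂ (Set.range v)))) {S : Finset ℝ}
    (hρsymm : ∀ c ∈ S, ∀ a b,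
      ∑ d, ρ c d a * ⟪(⟨v b, Submodule.subset_span ⟨b, rfl⟩⟩ : ↥(Submodule.span ℂ (Set.range v))), ⟨v d, Submodule.subset_span ⟨d, rfl⟩⟩⟫_ℂ =
        conj (∑ d, ρ c d b * ⟪(⟨v a, Submodule.subset_span ⟨a, rfl⟩⟩ : ↥(Submodule.span ℂ (Set.range v))), ⟨v d, Submodule.subset_span ⟨d, rfl⟩⟩⟫_ℂ)) :
    ∀ c ∈ S, ∀ u u' : ↥(Submodule.span ℂ (Set.range v)), ⟪u, R c u'⟫_ℂ = ⟪R c u, u'⟫_ℂ := by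
  refine hRsymm_of_span_entries hv fun c hc a b => ?_
  rw [inner_apply_of_coords (hR c), hρsymm c hc a b, ← inner_apply_of_coords (hR c), inner_conj_symm]

end Summit.HodgeConjecture.HodgeConjecture.Cruxes.H413.K2E1SpanOperatorMatrixLetters

end
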